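import Summits.ResolutionOfSingularities.ResolutionOfSingularities.Theorems.PlanarCurveTrapForms
import HarnessLib

/-!
# PlanarCurveTrapEngine — decomp-res node «CurveTrap» (lens-5 g26, critic row 177 CLEARED DECIDED +1), tree file 4/7 of the node

Content VERBATIM from the decomp-res lens-5 g26 node `HOME/decomp-res-lens-5/g26/CurveTrap.lean` (pin 39d382f9;
imports the landed tree only, carries nothing);
HOME = run/shared/lean/pub/decomp-res; critic row 177 CLEARED DECIDED +1; landing orders NODE §8 / INBOX :842 —
provenance, critic text and the lens header in full in the first
file of the node, `PlanarCurveTrapQPow`.  Namespace `…Theorems.CurveTrap`; `--supports stmt-ResolutionOfSingularities-31770`.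

## This file

§H ISOLATION ENGINE — arcs and approximate arcs kill `IsolatedTop`: §H.1 `section CurveLawKit` (g25 kit:
`not_isolatedTop_of_arc`, `hasseDeriv_pow_char_pow_mul`, `not_isolatedTop_of_X_pow_dvd`), §H.2 `section DegCong`
(`DegCong M`: agreement below total degree `M`, Mathlib `truncTotal`), §H.3 `section Engine`: THE APPROXIMATE-ARC
ENGINE `not_isolatedTop_of_approx`, ISO-1 `not_isolatedTop_of_X_pow_form` (`↑G = X_i^b R + Q`, `q ≤ b`, `Q ∈ S_q`),
ISO-2 `not_isolatedTop_of_curve_pow` (`↑G = (X_c + h(X_o))^q R + Q`, `h(0) = 0`, `Q ∈ S_q`) (continued `…2` where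
the cap cuts).  (This first part carries: `constantCoeff_arc`, `not_isolatedTop_of_arc`,
`hasseDeriv_pow_char_pow_mul`, `hasseDeriv_pow_char_pow_eq_zero`, `hasseDeriv_eq_zero_of_forall_dvd`,
`not_isolatedTop_of_X_pow_dvd`, `DegCong`, `DegCong.rfl'`, `DegCong.symm`, `DegCong.trans`, `DegCong.add`,
`DegCong.truncTotal_eq`, `DegCong.mul`, `DegCong.pow`, `degCong_coe_truncTotal`, `eq_zero_of_forall_X_pow_dvd`,
`X_pow_dvd_aeval_of_le_degree`, `coeff_add_ne_zero_of_mem_support_hasseDeriv`, `not_isolatedTop_of_approx`,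
`aeval_hasseDeriv_eq_zero_of_forall_le`, `not_isolatedTop_of_forall_le`, `not_isolatedTop_of_X_pow_form`.)

[WRITER NOTE (decomp-res writer g11): file split only (tree files ≤ 400 lines); namespace, sections, section
variables, the `open` block and every
declaration exactly as in the lens (the node's global dupNamespace-linter line is dropped — the library sets it);
ONE deletion (gate dedup
rule, critic :842 watch-list): the node's copy `eq_single_add_single_two` is NOT re-landed — it is LITERALLY the landed
`HauserPerlega2024.finsupp_eq_single_add_single` (`PointBlowupFlagTranslatedStep`, imported; namespace opened as in
the lens), cited by name at its two uses; no instance, no notation, no include/omit added.]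

(Sources: HauserPerlega2024 (characteristic-free resolution of surfaces by point blowups: Props. 3–4, the monomial
case); Hauser2010 Lectures VII–IX; CossartJannsenSaito2020 Ch. 5; Moh1987; BenitoVillamayor2014; the Hasse–Schmidt /
point-blowup flag formalism of the tree (Literature PointBlowupFlag*).)
-/

open MvPolynomial Finset
open Literature.AlgebraicGeometry.Resolution
open Literature.AlgebraicGeometry.Resolution.Hauser2010
open Literature.AlgebraicGeometry.Resolution.HauserPerlega2024
open Literature.AlgebraicGeometry.Resolution.PointBlowup
open Literature.AlgebraicGeometry.Resolution.WeightedBlowup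
open Summit.ResolutionOfSingularities.ResolutionOfSingularities.Theses
open Summit.ResolutionOfSingularities.ResolutionOfSingularities.Theorems.TightDefectClasses
open Summit.ResolutionOfSingularities.ResolutionOfSingularities.Theorems.TightDefectStrongWalks
open Summit.ResolutionOfSingularities.ResolutionOfSingularities.Theorems.ItineraryCutClasses
open Summit.ResolutionOfSingularities.ResolutionOfSingularities.Theorems.ProximityCut
open Summit.ResolutionOfSingularities.ResolutionOfSingularities.Theorems.ExitLaw
open Summit.ResolutionOfSingularities.ResolutionOfSingularities.Theorems.PlanarCut
open Summit.ResolutionOfSingularities.ResolutionOfSingularities.Theorems.CoefficientCut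
open Summit.ResolutionOfSingularities.ResolutionOfSingularities.Theorems.PlanarPort
open Summit.ResolutionOfSingularities.ResolutionOfSingularities.Theorems.SectionLift

namespace Summit.ResolutionOfSingularities.ResolutionOfSingularities.Theorems.CurveTrap

section CurveLawKit

variable {σ : Type} {K : Type} [Field K]

/-! ## §H ISOLATION ENGINE — arcs and approximate arcs kill `IsolatedTop`

§H.1 is `g25/extra/CurveLawKit.lean` verbatim (ARC CRITERION; q-power linearity of the Hasse derivatives).
§H.2 degree congruences (`DegCong`, via Mathlib `truncTotal`).  §H.3 the APPROXIMATE-ARC ENGINE and its two uses: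
(ISO-1) `↑G = X_i^q·R + S_q` and (ISO-2) `↑G = (X_c + h(X_o))^q·R + S_q` are NOT isolated top points. -/

/-- Constant coefficients along an arc through the origin: `(θ g)(0) = g(0)`. [folklore] -/
theorem constantCoeff_arc (θ : MvPolynomial σ K →ₐ[K] PowerSeries K)
    (hθ0 : ∀ i, PowerSeries.constantCoeff (θ (X i)) = 0) (g : MvPolynomial σ K) :
    PowerSeries.constantCoeff (θ g) = MvPolynomial.constantCoeff g := by
  have h : (PowerSeries.constantCoeff (R := K)).comp θ.toRingHom = MvPolynomial.constantCoeff := by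
    refine MvPolynomial.ringHom_ext (fun c => ?_) (fun i => ?_)
    · simp [AlgHom.toRingHom_eq_coe]
    · simpa using hθ0 i
  exact congrArg (fun φ : MvPolynomial σ K →+* K => φ g) h

/-- **ARC CRITERION.** An arc through the origin, non-trivial on some letter, inside the top locus `V(J_F)` (it kills every
`∂^{(d)} F`, `0 < |d| < q`) makes the origin a NON-isolated top point. [new] [folklore] -/
theorem not_isolatedTop_of_arc {q : ℕ} {F : MvPolynomial σ K} (θ : MvPolynomial σ K →ₐ[K] PowerSeries K)
    (hθ0 : ∀ i, PowerSeries.constantCoeff (θ (X i)) = 0) {i₀ : σ} (hne : θ (X i₀) ≠ 0)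
    (hJ : ∀ d : σ →₀ ℕ, d ≠ 0 → d.degree < q → θ (hasseDeriv K d F) = 0) : ¬ IsolatedTop q F := by
  classical
  rintro ⟨N, g, hg0, hg⟩
  have hker : topIdeal q F ≤ RingHom.ker θ.toRingHom := by
    refine Ideal.span_le.mpr ?_
    rintro y ⟨d, ⟨hd0, hdq⟩, rfl⟩
    simpa [RingHom.mem_ker] using hJ d hd0 hdq
  have h1 : θ g * θ (X i₀) ^ N = 0 := by
    have := hker (hg i₀)
    simpa [RingHom.mem_ker, map_mul, map_pow] using this
  rcases mul_eq_zero.mp h1 with h | h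
  · apply hg0
    rw [← constantCoeff_arc θ hθ0 g, h, map_zero]
  · exact hne (pow_eq_zero_iff (n := N) (by
      rintro rfl
      simp at h) |>.mp h)

section QPower

variable [DecidableEq σ] (p : ℕ) [Fact p.Prime] [CharP K p]

/-- **q-power linearity of the Hasse derivatives** (`q = p^e`, `|α| < q`): `∂^{(α)}(f^q g) = f^q ∂^{(α)} g`.
(Tree: `isDiffOpLE_hasseDeriv` + `IsDiffOpLE.apply_pow_char_pow_mul'`.) [folklore] -/
theorem hasseDeriv_pow_char_pow_mul (e : ℕ) {α : σ →₀ ℕ} (hα : α.degree < p ^ e) (f g : MvPolynomial σ K) :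
    hasseDeriv K α (f ^ p ^ e * g) = f ^ p ^ e * hasseDeriv K α g :=
  (isDiffOpLE_hasseDeriv K α.degree α le_rfl).apply_pow_char_pow_mul' p hα f g

/-- A `q`-th power has vanishing Hasse derivatives of order `0 < |α| < q`. [folklore] -/
theorem hasseDeriv_pow_char_pow_eq_zero (e : ℕ) {α : σ →₀ ℕ} (hα0 : α ≠ 0) (hα : α.degree < p ^ e)
    (f : MvPolynomial σ K) : hasseDeriv K α (f ^ p ^ e) = 0 := by
  have h := hasseDeriv_pow_char_pow_mul (K := K) p e hα f 1
  rw [mul_one] at h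
  rw [h, ← C_1, ← monomial_zero', hasseDeriv_monomial_eq_zero_of_not_le, mul_zero]
  intro hle
  exact hα0 (le_antisymm hle bot_le)

/-- A `q`-POWER-SUPPORTED polynomial (every exponent divisible by `q = p^e`) has vanishing Hasse derivatives of order
`0 < |α| < q` (each monomial is `c·(x^{d/q})^q`). [folklore] -/
theorem hasseDeriv_eq_zero_of_forall_dvd (e : ℕ) {Q : MvPolynomial σ K} (hQ : ∀ d ∈ Q.support, ∀ i, p ^ e ∣ d i)
    {α : σ →₀ ℕ} (hα0 : α ≠ 0) (hα : α.degree < p ^ e) : hasseDeriv K α Q = 0 := by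
  classical
  conv_lhs => rw [Q.as_sum]
  rw [map_sum]
  refine Finset.sum_eq_zero fun d hd => ?_
  -- `monomial d c = C c * (monomial (d / q) 1) ^ q`
  obtain ⟨d', hd'⟩ : ∃ d' : σ →₀ ℕ, d = p ^ e • d' := by
    refine ⟨Finsupp.mapRange (fun n => n / p ^ e) (by simp) d, ?_⟩
    ext i
    obtain ⟨m, hm⟩ := hQ d hd i
    have hq : 0 < p ^ e := pow_pos (Fact.out : p.Prime).pos e
    simp [hm, Nat.mul_div_cancel_left m hq]
  have hmon : monomial d (coeff d Q) = (monomial d' (1 : K)) ^ p ^ e * C (coeff d Q) := by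
    rw [monomial_pow, one_pow, ← hd', mul_comm, C_mul_monomial, mul_one]
  rw [hmon, hasseDeriv_pow_char_pow_mul (K := K) p e hα, ← monomial_zero', hasseDeriv_monomial_eq_zero_of_not_le,
    mul_zero]
  intro hle
  exact hα0 (le_antisymm hle bot_le)

/-- **CURVE LAW, given-letter cases (C1)/(C3):** `X_i^{q k} ∣ G` with `k ≥ 1` and a second letter `j ≠ i` make the origin
a NON-isolated top point of `G` (`q = p^e`): `J_G ⊆ (X_i)` by q-power linearity, and the arc `X_i ↦ 0`, `X_l ↦ t` (`l ≠ i`)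
kills it. [new] [folklore] -/
theorem not_isolatedTop_of_X_pow_dvd [DecidableEq K] (e : ℕ) {G : MvPolynomial σ K} {i j : σ} (hij : j ≠ i) {k : ℕ}
    (hk : 0 < k) (hdiv : X i ^ (p ^ e * k) ∣ G) : ¬ IsolatedTop (p ^ e) G := by
  classical
  obtain ⟨H, rfl⟩ := hdiv
  let θ : MvPolynomial σ K →ₐ[K] PowerSeries K := aeval fun l => if l = i then 0 else PowerSeries.X
  have hθi : θ (X i) = 0 := by simp [θ]
  have hθj : θ (X j) = PowerSeries.X := by simp [θ, if_neg hij]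
  refine not_isolatedTop_of_arc θ (fun l => ?_) (i₀ := j) (by rw [hθj]; exact PowerSeries.X_ne_zero) ?_
  · by_cases hl : l = i
    · subst hl; simp [hθi]
    · simp [θ, if_neg hl]
  · intro d hd0 hdq
    have hpow : X i ^ (p ^ e * k) * H = (X i ^ k) ^ p ^ e * H := by rw [← pow_mul, mul_comm k]
    rw [hpow, hasseDeriv_pow_char_pow_mul (K := K) p e hdq, map_mul, map_pow, map_pow, hθi,
      zero_pow (Nat.pos_iff_ne_zero.mp hk), zero_pow (pow_ne_zero e (Fact.out : p.Prime).ne_zero), zero_mul]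

end QPower

end CurveLawKit

section DegCong

variable {σ : Type*} {L : Type*} [Field L]

/-! ### §H.2 Degree congruences `f ≡ g (mod deg ≥ n)` -/

/-- `f ≡ g` modulo monomials of total degree `≥ n`.  DEFINITION (support). -/
def DegCong (n : ℕ) (f g : MvPowerSeries σ L) : Prop :=
  ∀ d : σ →₀ ℕ, d.degree < n → MvPowerSeries.coeff d f = MvPowerSeries.coeff d g

/-- [folklore] -/
theorem DegCong.rfl' {n : ℕ} {f : MvPowerSeries σ L} : DegCong n f f := fun _ _ => rfl

/-- [folklore] -/
theorem DegCong.symm {n : ℕ} {f g : MvPowerSeries σ L} (h : DegCong n f g) : DegCong n g f :=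
  fun d hd => (h d hd).symm

/-- [folklore] -/
theorem DegCong.trans {n : ℕ} {f g k : MvPowerSeries σ L} (h₁ : DegCong n f g) (h₂ : DegCong n g k) :
    DegCong n f k := fun d hd => (h₁ d hd).trans (h₂ d hd)

/-- [folklore] -/
theorem DegCong.add {n : ℕ} {f₁ g₁ f₂ g₂ : MvPowerSeries σ L} (h₁ : DegCong n f₁ g₁) (h₂ : DegCong n f₂ g₂) :
    DegCong n (f₁ + f₂) (g₁ + g₂) := fun d hd => by rw [map_add, map_add, h₁ d hd, h₂ d hd]

/-- [folklore] -/
theorem DegCong.truncTotal_eq [Finite σ] {n : ℕ} {f g : MvPowerSeries σ L} (h : DegCong n f g) :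
    MvPowerSeries.truncTotal n f = MvPowerSeries.truncTotal n g := by
  ext d
  rw [MvPowerSeries.coeff_truncTotal_eq_ite f, MvPowerSeries.coeff_truncTotal_eq_ite g]
  split_ifs with hd
  · exact h d hd
  · rfl

/-- Products respect the congruence (degrees add). [folklore] -/
theorem DegCong.mul [Finite σ] {n : ℕ} {f₁ g₁ f₂ g₂ : MvPowerSeries σ L} (h₁ : DegCong n f₁ g₁)
    (h₂ : DegCong n f₂ g₂) : DegCong n (f₁ * f₂) (g₁ * g₂) := fun d hd => by
  rw [← MvPowerSeries.coeff_truncTotal_mul_truncTotal_eq_coeff_mul f₁ f₂ hd, h₁.truncTotal_eq, h₂.truncTotal_eq,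
    MvPowerSeries.coeff_truncTotal_mul_truncTotal_eq_coeff_mul g₁ g₂ hd]

/-- [folklore] -/
theorem DegCong.pow [Finite σ] {n : ℕ} {f g : MvPowerSeries σ L} (h : DegCong n f g) :
    ∀ k : ℕ, DegCong n (f ^ k) (g ^ k)
  | 0 => by rw [pow_zero, pow_zero]; exact DegCong.rfl'
  | k + 1 => by rw [pow_succ, pow_succ]; exact (DegCong.pow h k).mul h

/-- The total-degree truncation is congruent to the series. [folklore] -/
theorem degCong_coe_truncTotal [Finite σ] (n : ℕ) (f : MvPowerSeries σ L) :
    DegCong n ((MvPowerSeries.truncTotal n f : MvPolynomial σ L) : MvPowerSeries σ L) f := fun d hd => by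
  rw [MvPolynomial.coeff_coe, MvPowerSeries.coeff_truncTotal f hd]

end DegCong

section Engine

variable {σ : Type} [DecidableEq σ] {L : Type} [Field L]

/-! ### §H.3 The approximate-arc engine; ISO-1 and ISO-2 -/

omit [DecidableEq σ] in
/-- A power series divisible by every power of `T` is `0`. [folklore] -/
theorem eq_zero_of_forall_X_pow_dvd {f : PowerSeries L} (h : ∀ M : ℕ, PowerSeries.X ^ M ∣ f) : f = 0 := by
  ext m
  rw [map_zero]
  exact (PowerSeries.X_pow_dvd_iff.mp (h (m + 1))) m (Nat.lt_succ_self m)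

omit [DecidableEq σ] in
/-- ARC ORDER: an arc through the origin sends a polynomial with all monomials of degree `≥ n` into `(T^n)`. [folklore] -/
theorem X_pow_dvd_aeval_of_le_degree (φ : σ → PowerSeries L) (hφ : ∀ l, PowerSeries.constantCoeff (φ l) = 0)
    {n : ℕ} {g : MvPolynomial σ L} (hg : ∀ β ∈ g.support, n ≤ β.degree) :
    PowerSeries.X ^ n ∣ aeval φ g := by
  classical
  conv_rhs => rw [g.as_sum]
  rw [map_sum]
  refine Finset.dvd_sum fun β hβ => ?_
  rw [aeval_monomial]
  refine Dvd.dvd.mul_left ?_ _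
  have h1 : PowerSeries.X ^ β.degree ∣ β.prod fun i k => φ i ^ k := by
    rw [Finsupp.prod, Finsupp.degree_apply, ← Finset.prod_pow_eq_pow_sum]
    exact Finset.prod_dvd_prod_of_dvd _ _ fun i _ => pow_dvd_pow_of_dvd (PowerSeries.X_dvd_iff.mpr (hφ i)) _
  exact (pow_dvd_pow _ (hg β hβ)).trans h1

/-- HASSE SUPPORT: a monomial `x^β` of `∂^{(α)} E` comes from the monomial `x^{α+β}` of `E`. [folklore] -/
theorem coeff_add_ne_zero_of_mem_support_hasseDeriv {α β : σ →₀ ℕ} {E : MvPolynomial σ L}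
    (h : β ∈ (hasseDeriv L α E).support) : coeff (α + β) E ≠ 0 := by
  intro h0
  rw [mem_support_iff, coeff_hasseDeriv, h0, mul_zero] at h
  exact h rfl

/-- **THE APPROXIMATE-ARC ENGINE.** If an arc `φ` through the origin (non-trivial on a letter) kills, for every `M`, the
Hasse derivatives `∂^{(α)} P_M` (`0 < |α| < q`) of some polynomial `P_M` agreeing with `G` below degree `M + q` up to
`(T^M)`, then the origin is NOT an isolated top point of `G`. [new] [folklore] -/
theorem not_isolatedTop_of_approx {q : ℕ} {G : MvPolynomial σ L} (φ : σ → PowerSeries L)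
    (hφ : ∀ l, PowerSeries.constantCoeff (φ l) = 0) {i₀ : σ} (hne : φ i₀ ≠ 0)
    (happrox : ∀ M : ℕ, ∃ P : MvPolynomial σ L, (∀ d : σ →₀ ℕ, d.degree < M + q → coeff d G = coeff d P) ∧
      ∀ α : σ →₀ ℕ, α ≠ 0 → α.degree < q → PowerSeries.X ^ M ∣ aeval φ (hasseDeriv L α P)) :
    ¬ IsolatedTop q G := by
  classical
  refine not_isolatedTop_of_arc (aeval φ) (fun l => by rw [aeval_X]; exact hφ l) (i₀ := i₀)
    (by rw [aeval_X]; exact hne) fun α hα0 hαq => ?_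
  refine eq_zero_of_forall_X_pow_dvd fun M => ?_
  obtain ⟨P, hGP, hP⟩ := happrox M
  have hsplit : hasseDeriv L α G = hasseDeriv L α P + hasseDeriv L α (G - P) := by
    rw [← map_add, add_sub_cancel]
  rw [hsplit, map_add]
  refine dvd_add (hP α hα0 hαq) (X_pow_dvd_aeval_of_le_degree φ hφ fun β hβ => ?_)
  have hc := coeff_add_ne_zero_of_mem_support_hasseDeriv hβ
  by_contra hlt
  push Not at hlt
  apply hc
  rw [coeff_sub, hGP (α + β) (by rw [map_add]; omega), sub_self]

/-- The letter-killing arc `X_i ↦ 0`, `X_l ↦ T` kills `∂^{(α)} G` when every monomial of `G` has `X_i`-degree `≥ q`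
(`|α| < q`). [folklore] -/
theorem aeval_hasseDeriv_eq_zero_of_forall_le {q : ℕ} {G : MvPolynomial σ L} {i : σ}
    (h : ∀ d ∈ G.support, q ≤ d i) {α : σ →₀ ℕ} (hαq : α.degree < q) :
    aeval (fun l => if l = i then (0 : PowerSeries L) else PowerSeries.X) (hasseDeriv L α G) = 0 := by
  classical
  rw [(hasseDeriv L α G).as_sum, map_sum]
  refine Finset.sum_eq_zero fun β hβ => ?_
  have hc := coeff_add_ne_zero_of_mem_support_hasseDeriv hβ
  have hβi : β i ≠ 0 := by
    intro hβi
    have h1 := h (α + β) (mem_support_iff.mpr hc)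
    have h2 : α i ≤ α.degree := Finsupp.le_degree i α
    rw [Finsupp.add_apply, hβi, add_zero] at h1
    omega
  rw [aeval_monomial, Finsupp.prod, Finset.prod_eq_zero (Finsupp.mem_support_iff.mpr hβi) (by simp [zero_pow hβi]),
    mul_zero]

/-- **ISO-1 (polynomial form).** If every monomial of `G` has `X_i`-degree `≥ q` and there is a second letter, the
origin is NOT an isolated top point (the top locus contains the `X_j`-axis). [new] [folklore] -/
theorem not_isolatedTop_of_forall_le {q : ℕ} {G : MvPolynomial σ L} {i j : σ} (hij : j ≠ i)
    (h : ∀ d ∈ G.support, q ≤ d i) : ¬ IsolatedTop q G := by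
  classical
  refine not_isolatedTop_of_approx (fun l => if l = i then 0 else PowerSeries.X)
    (fun l => by by_cases hl : l = i <;> simp [hl]) (i₀ := j) (by rw [if_neg hij]; exact PowerSeries.X_ne_zero)
    fun M => ⟨G, fun d _ => rfl, fun α _ hαq => ?_⟩
  rw [aeval_hasseDeriv_eq_zero_of_forall_le h hαq]
  exact dvd_zero _

variable (p : ℕ) [Fact p.Prime] [CharP L p]

/-- **ISO-1 (series form).** `↑G = X_i^q · R + Q` with `Q ∈ S_q` (`q = p^e`) and a second letter: the origin is NOT an
isolated top point. [new] [folklore] -/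
theorem not_isolatedTop_of_X_pow_form (e : ℕ) {G : MvPolynomial σ L} {i j : σ} (hij : j ≠ i)
    {R Q : MvPowerSeries σ L} (hG : (G : MvPowerSeries σ L) = MvPowerSeries.X i ^ p ^ e * R + Q)
    (hQ : IsQPow (p ^ e) Q) : ¬ IsolatedTop (p ^ e) G := by
  classical
  have hG₂ : ∀ d ∈ (G - deletePthPowers (p ^ e) G).support, ∀ l, p ^ e ∣ d l := by
    intro d hd l
    by_contra hl
    rw [mem_support_iff, coeff_sub, coeff_deletePthPowers, if_neg (fun h => hl ((isPthPowerExponent_iff _ _).mp h l)),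
      sub_self] at hd
    exact hd rfl
  have hG₁ : ∀ d ∈ (deletePthPowers (p ^ e) G).support, p ^ e ≤ d i := by
    intro d hd
    rw [mem_support_iff, coeff_deletePthPowers] at hd
    split_ifs at hd with hdiv
    · exact absurd rfl hd
    · by_contra hlt
      push Not at hlt
      apply hd
      have h1 := congrArg (MvPowerSeries.coeff d) hG
      rw [MvPolynomial.coeff_coe, map_add, coeff_X_pow_mul_of_lt hlt, zero_add] at h1
      rw [h1]
      rw [isPthPowerExponent_iff] at hdiv
      push Not at hdiv
      obtain ⟨l, hl⟩ := hdiv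
      exact hQ.coeff_eq_zero hl
  refine not_isolatedTop_of_approx (fun l => if l = i then 0 else PowerSeries.X)
    (fun l => by by_cases hl : l = i <;> simp [hl]) (i₀ := j) (by rw [if_neg hij]; exact PowerSeries.X_ne_zero)
    fun M => ⟨G, fun d _ => rfl, fun α hα0 hαq => ?_⟩
  have hsplit : hasseDeriv L α G = hasseDeriv L α (deletePthPowers (p ^ e) G) +
      hasseDeriv L α (G - deletePthPowers (p ^ e) G) := by
    rw [← map_add, add_sub_cancel]
  rw [hsplit, hasseDeriv_eq_zero_of_forall_dvd (K := L) p e hG₂ hα0 hαq, add_zero,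
    aeval_hasseDeriv_eq_zero_of_forall_le hG₁ hαq]
  exact dvd_zero _

end Engine

end Summit.ResolutionOfSingularities.ResolutionOfSingularities.Theorems.CurveTrap
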